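import Mathlib
import Literature.MathematicalPhysics.QuantumFieldTheory.Balaban1983to89.B6QGQLower276
import Literature.MathematicalPhysics.QuantumFieldTheory.Balaban1983to89.Beta.CombesThomasFormOp

/-!
# Bałaban [B6] p. 237 / [B5] p. 36 — mesh-uniform exponential decay of `G' = (Δ^η + aQ*Q)⁻¹` and of the kernel of
# `Q'G'Q'*` (and of all its compression inverses) on the WHOLE lattice, scalar case, by the Combes–Thomas
# conjugation argument the papers name and do not carry out

**Sources (verbatim).**

* [B6] T. Bałaban, *Propagators and renormalization transformations for lattice gauge theories. II*, Commun.
  Math. Phys. **96** (1984) 223–250, p. 237 (first paragraph, about `C^ξ_□ = (Q'G'^ξ(□̃)²Q'*)⁻¹` after the lower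
  bound (2.76)–(2.78) p. 236 for `Q'G'_jQ'*` «on the whole lattice» (2.74)):
  «Of course we have also a bound from above and an exponential decay of the kernel of Q'G'^ξ(□̃)²Q'* with the
  decay rate δ₀. Hence the operator C^ξ_□ is bounded from above and below by absolute constants. We can use the
  theory developed in Sect. 5 [3] to conclude that it has an exponential decay with a decay rate δ₁ depending on δ₀
  and the bound γ₀. Another way to prove it is to consider the operator e^{⟨a,·⟩}Q'G'^ξ(□̃)²Q'*e^{−⟨a,·⟩}, and to
  prove that it is almost equal to the operator without the exponential functions, the difference being of the
  order O(|a|), for a small vector a ∈ R^d. This gives a bound for this operator almost the same as (2.78), which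
  implies an exponential decay. Thus we have |C^ξ_□(y, y')| ≤ O(1)e^{−δ₁|y−y'|} (2.79)».
* [B5] T. Bałaban, *Propagators and renormalization transformations for lattice gauge theories. I*, Commun.
  Math. Phys. **95** (1984) 17–40, p. 36: «Probably the simplest proof of the exponential decay properties can be
  obtained by relating G on the torus to G on the whole lattice ηZ^d in the usual way, and then proving that the operator
  e^{−⟨q,x⟩}Δ_a e^{⟨q,x⟩} − Δ_a is a small perturbation of Δ_a for vectors q∈R^d sufficiently small. Instead we
  construct a random walk representation of the kind described in [2].»  ([2] = [B4].)
* [B4] T. Bałaban, *Regularity and decay of lattice Green's functions*, Commun. Math. Phys. **89** (1983) 571–597,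
  Theorem p. 573, (1.10): «|(D^η_{A,μ}G_k(Ω,A)f)(x)|, |(G_k(Ω,A)f)(x)| ≤ c₀ exp(−δ₀ dist(x, supp f))‖f‖_∞» for
  `G_k(Ω,A) = (−Δ^η_{A,Ω} + a_kQ_k*Q_k)⁻¹`, `Ω ⊂` the `η`-lattice (typed leaf `B4.ThmPrinted`); and Sect. 5 Theorem
  p. 594 (5.6) ⟹ (5.7) (kernel-checked for arbitrary `Ω ⊂ ℤ^d`: `B4Sect5Exhaustion.sect5ThmSetOmega_holds`).

**What this file kernel-checks** (scalar case `U = 1`, gauge field `A = 0`, `N = 1` internal index; the fine lattice is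
`ℤ^d` in SITE units with mesh `η = 1/(n+1)`, blocks `B(y) = {p : ⌊p/(n+1)⌋ = y}` of `(n+1)^d` sites, the site matrix
`AX n a = (n+1)²(−Δ_sites) + a(n+1)^{−d}·1[same block]` of `Δ^η + aQ*Q` and its B4 kernel `Aker n a` are those of
`B6QGQLower276`; `G'_Ω := limInv Ω (Aker n a)` is B4Sect5Exhaustion's exhaustion-limit inverse = the unique exponentially
bounded two-sided inverse of `A_Ω` (node `B4Sect5Exhaustion`), `G' := G'_{ℤ^d}`; `Q'G'Q'*` has the unit-lattice kernel
`kerQGQ n a y y' = (n+1)^{−d} Σ_{p∈B(y)} Σ_{q∈B(y')} G'(p,q)` of `B6QGQLower276`):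

1. `conjError_toMat` — **the Combes–Thomas perturbation estimate of [B5] p. 36 / [B6] p. 237, mesh-free**: for every
   finite `Λ ⊂ ℤ^d`, every weight `φ` with bond oscillation `≤ δ_u η` and block oscillation `≤ δ_u`, and every `w`,
   `Σ_{j,k}(e^{φ_j−φ_k} − 1)(A_Λ)_{jk} w_j w_k ≥ −(min(2,a)/2)‖w‖²`, where `δ_u = deltaU d a = min(1, min(2,a)/(4(d+a+1)))`
   (`smallness`: `2dδ_u² + a(e^{δ_u} − 1) ≤ min(2,a)/2`).  Mechanism: `Beta.CombesThomasFormOp.conjError_lap_add_blocks_ge`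
   (pv23-g3) applied to `lap c + Σ_b m_b u_b ⊗ u_b`, which agrees with the Dirichlet compression `A_Λ` OFF the diagonal;
   the excess diagonal of the compression carries the factor `e⁰ − 1 = 0`.
2. `finInv_setDecay` — **finite volume, uniformly in `Λ` and `η`**: for `S, T ⊆ Λ` at site distance `≥ R`,
   `|Σ_{p∈S}Σ_{q∈T} f(p)(A_Λ⁻¹)(p,q)g(q)| ≤ (2/min(2,a)) e^{−δ_u R/(n+1)} ‖f‖_{ℓ²(S)}‖g‖_{ℓ²(T)}`
   (`Beta.CombesThomasFormOp.setDecay_form_op` with coercivity `A_Λ ≥ min(2,a)` from `B6QGQLower276.hyp56Z_Aker` and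
   the weight `φ = δ_u η·dist(·,T)`).
3. `gPrime_setDecay`, `gPrime_entry_decay`, `gPrime_block_decay` — **the whole lattice** (and every `Ω ⊆ ℤ^d`): the same
   bound for `G'_Ω`, by B4Sect5Exhaustion's `tendsto_limInv` (`A_{Ω∩[−m,m]^d}⁻¹ → G'_Ω` entrywise); in particular
   `|G'_Ω(p,q)| ≤ (2/min(2,a)) e^{−δ_u|p−q|_∞/(n+1)}` (decay in the PHYSICAL distance `η|p−q|_∞`, constants depending on
   `d, a` only) and `|Σ_{p∈B(y)}Σ_{q∈B(y')} G'(p,q)| ≤ (n+1)^d (2/min(2,a)) e^{δ_u} e^{−δ_u|y−y'|_∞}`.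
4. `abs_kerQGQ_le_unif` — **«a bound from above and an exponential decay of the kernel» of `Q'G'Q'*`, MESH-FREE**:
   `|(Q'G'Q'*)(y,y')| ≤ c_u e^{−δ_u|y−y'|_∞}`, `c_u = cU d a = (2/min(2,a))e^{δ_u}`.
5. `hyp56Z_KerQGQ_unif` — **B4's condition (5.6) for `Q'G'Q'*` on `Ω = ℤ^d` with mesh-free constants**
   `(γ₀, c₀, δ₀) = (gammaQ d a, cU d a, deltaU d a)` («bounded from above and below by absolute constants»; the lower
   bound is B6 (2.76), node `B6QGQLower276.finCoercive_KerQGQ`).  This supersedes `B6QGQLower276.hyp56Z_KerQGQ`, whose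
   decay constants `cQ d n a`, `deltaQ d n a` depended on the mesh.
6. `qGqInv_decay_unif` — **«use the theory developed in Sect. 5 [3] to conclude that it has an exponential decay with a
   decay rate δ₁ depending on δ₀ and the bound γ₀»**: for EVERY `Λ ⊆ ℤ^d` (finite or not),
   `|(Q'G'Q'*)_Λ⁻¹(y,y')| ≤ cInv d a · e^{−deltaInv d a·|y−y'|_∞}` with `cInv = c⋆(d,1,γ₀,c_u,δ_u)`,
   `deltaInv = δ⋆(d,1,γ₀,c_u,δ_u)` of `B4Sect5Proof` — functions of `d, a` only (`B4Sect5Exhaustion.limInv_abs_le`).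

**DICTIONARY (print ↦ Lean).**  `ξZ^d` / `ηZ^d`, mesh `η = ξ = L^{−j}` ↦ `ℤ^d` in site units, `η = 1/(n+1)` (any
`n : ℕ`; print's `n+1 = L^j`); `Δ^η + aQ*Q` (scalar, `A = 0`) ↦ site matrix `AX n a` / kernel `Aker n a`
(`B6QGQLower276`); `G'` on the whole lattice ↦ `limInv Set.univ (Aker n a)`; B4's `G_k(Ω, 0)` / the compressions
`A_Λ = ΛAΛ` of Sect. 5 ↦ `toMat Λ (Aker n a)`, `finInv Λ`, `limInv Ω`; unit-lattice points `y` and blocks `B^j(y)` ↦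
`y : Fin d → ℤ`, `B n y`; `Q'G'Q'*` ↦ `kerQGQ n a` / `KerQGQ n a`; `(Q'G'Q'*)_Λ⁻¹` ↦ `limInv Λ (KerQGQ n a)`;
`|y − y'|` ↦ the sup distance `dist y y'` on `Fin d → ℤ`; «small vector a ∈ R^d», `e^{⟨a,·⟩}` ↦ the weight
`e^{φ}`, `φ = δ_u η dist(·,T)` (a distance weight instead of a linear one — the standard Combes–Thomas variant; bond
oscillation `≤ δ_u η` is what is used); «O(|a|)» ↦ the defect bound `2dδ_u² + a(e^{δ_u} − 1) ≤ min(2,a)/2`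
(`smallness`); «absolute constants», «δ₁ depending on δ₀ and the bound γ₀» ↦ `deltaU d a`, `cU d a`, `gammaQ d a`,
`cInv d a`, `deltaInv d a` — explicit functions of `d` and `a` alone.

**HONEST SCOPE.**  (i) Scalar case only (`U = 1`, no background field); the vector/covariant operators of [B5]/[B6]
are not touched.  (ii) First power: the printed sentence of [B6] p. 237 concerns `Q'G'^ξ(□̃)²Q'*` (square of `G'`,
restricted to a cube `□̃`); this file treats `Q'G'Q'*` — the operator of (2.74)–(2.76) p. 236 — on the whole lattice,
and its compressions `(Q'G'Q'*)_Λ`, `Λ ⊆ ℤ^d`.  (iii) Norms: the bounds are `ℓ²(counting measure)` SET-TO-SET bounds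
and the ENTRY bounds they imply; they are NOT print's sup-norm statements (1.10)/(1.110) (`‖f‖_∞` source, pointwise
target), which need the local regularity theory of [B4] §2, nor the fine–fine entry improvement `|x−x'|^{2−d}`; the
entry bound `|G'(p,q)| ≤ (2/min(2,a))e^{−δ_u η|p−q|}` is `O(1)`, not `O(η^{d}|x−x'|^{2−d})`.  For the BLOCK kernel
`Q'G'Q'*` the `ℓ²` bound is sharp in `η` (the averaging factors `(n+1)^{−d}` compensate exactly), which is why items
4–6 are mesh-free.  (iv) Rates and constants are ours (`deltaU`, `cU`, `cInv`, `deltaInv`), not print's `δ₀, δ₁, O(1)`.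
(v) `G'_Ω` for `Ω ≠ ℤ^d` is the exhaustion limit of Dirichlet compressions `(ΩAΩ)⁻¹` of Sect. 5 of [B4] (node
`B4Sect5Exhaustion`), which is B4's `G_k(Ω,0)` only up to the boundary convention of [B4] (1.3)–(1.4); for `Ω = ℤ^d`
there is no boundary.  (vi) Torus versions (print's primary setting in [B5]/[B6] §1) are not derived here («relating G
on the torus to G on the whole lattice … in the usual way» is a separate step).

**ABSOLUTE-RULE CENSUS.**  Hypothesis-free: every theorem below is proved from Mathlib and kernel-checked tree modules
(`B6QGQLower276`, `B4Sect5Exhaustion`, `B4Sect5L2`, `B4Sect5Proof`, `Beta.CombesThomasForm(Op)`); no statement of the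
papers under audit is used as a hypothesis; the quotations above only LOCATE the content.  Tags: `[folklore]` for
lattice bookkeeping and the Combes–Thomas mechanism [cite: CombesThomas1973, §II]; `[cite: …]` tags on items 3–6 name
the printed sentences whose scalar whole-lattice content they discharge, in the scope stated.
-/

namespace Literature.MathematicalPhysics.QuantumFieldTheory.Balaban1983to89.B6QGQDecay237

open Finset Real Filter Topology
open B4Sect5Exhaustion B4Sect5L2 B6QGQLower276
open B4Sect5Proof (cStar deltaStar cStar_pos deltaStar_pos isUnit_of_hyp56)
open Beta.CombesThomasForm (lap lap_apply inv_sq_mul_cosh_sub_one_le abs_exp_sub_one_le)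
open Beta.CombesThomasFormOp (setDecay_form_op conjError_lap_add_blocks_ge)

noncomputable section

variable {d : ℕ}

/-! ## §1  Constants (all depending on `d` and `a` only — never on the mesh `η = 1/(n+1)`) -/

/-- The Combes–Thomas rate `δ_u(d,a) = min(1, min(2,a)/(4(d+a+1)))` (per unit of PHYSICAL distance `η·|p−q|_∞`);
ours, not print's `δ₀`. [folklore] -/
def deltaU (d : ℕ) (a : ℝ) : ℝ := min 1 (min 2 a / (4 * ((d : ℝ) + a + 1)))

/-- The block-kernel constant `c_u(d,a) = (2/min(2,a))·e^{δ_u}`. [folklore] -/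
def cU (d : ℕ) (a : ℝ) : ℝ := 2 / min 2 a * Real.exp (deltaU d a)

/-- `δ_u > 0` for `a > 0`. [folklore] -/
theorem deltaU_pos (d : ℕ) {a : ℝ} (ha : 0 < a) : 0 < deltaU d a := by
  unfold deltaU
  have : 0 < min 2 a := lt_min two_pos ha
  exact lt_min one_pos (by positivity)

/-- `δ_u ≤ 1`. [folklore] -/
theorem deltaU_le_one (d : ℕ) (a : ℝ) : deltaU d a ≤ 1 := min_le_left _ _

/-- `c_u > 0` for `a > 0`. [folklore] -/
theorem cU_pos (d : ℕ) {a : ℝ} (ha : 0 < a) : 0 < cU d a := by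
  unfold cU
  have : 0 < min 2 a := lt_min two_pos ha
  positivity

/-- **The `η`-free smallness condition** `2d·δ_u² + a(e^{δ_u} − 1) ≤ min(2,a)/2`. [folklore] -/
theorem smallness (d : ℕ) {a : ℝ} (ha : 0 < a) :
    2 * d * deltaU d a ^ 2 + a * (Real.exp (deltaU d a) - 1) ≤ min 2 a / 2 := by
  set δ := deltaU d a with hδdef
  set σ := min 2 a with hσdef
  have hσ : 0 < σ := lt_min two_pos ha
  have hδ0 : 0 ≤ δ := (deltaU_pos d ha).le
  have hδ1 : δ ≤ 1 := deltaU_le_one d a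
  have hδ2 : δ ≤ σ / (4 * ((d : ℝ) + a + 1)) := min_le_right _ _
  have hexp : Real.exp δ - 1 ≤ 2 * δ := by
    have h := Real.abs_exp_sub_one_le (x := δ) (by rw [abs_of_nonneg hδ0]; exact hδ1)
    rw [abs_of_nonneg hδ0] at h
    exact (le_abs_self _).trans h
  have hsq : δ ^ 2 ≤ δ := by nlinarith
  have hD : 0 < (d : ℝ) + a + 1 := by positivity
  have h3 : 2 * δ * ((d : ℝ) + a) ≤ σ / 2 := by
    have : δ * (4 * ((d : ℝ) + a + 1)) ≤ σ := (le_div_iff₀ (by positivity)).1 hδ2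
    nlinarith
  have hd0 : (0 : ℝ) ≤ d := Nat.cast_nonneg d
  nlinarith [mul_le_mul_of_nonneg_left hexp ha.le, mul_le_mul_of_nonneg_left hsq (by positivity : (0:ℝ) ≤ 2 * d)]

/-! ## §2  Lattice geometry: adjacency, block distances, the distance-to-a-set weight -/

/-- Adjacency indicator `Σ_μ (1[q = p + e_μ] + 1[q = p − e_μ])`. [folklore] -/
def adjR (p q : X d) : ℝ := ∑ μ : Fin d, ((if q = p + e μ then (1 : ℝ) else 0) + (if q = p - e μ then 1 else 0))

/-- The adjacency indicator is nonnegative. [folklore] -/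
theorem adjR_nonneg (p q : X d) : 0 ≤ adjR p q :=
  Finset.sum_nonneg fun μ _ => add_nonneg (by split_ifs <;> norm_num) (by split_ifs <;> norm_num)

/-- The adjacency indicator is symmetric. [folklore] -/
theorem adjR_symm (p q : X d) : adjR p q = adjR q p := by
  unfold adjR
  refine Finset.sum_congr rfl fun μ _ => ?_
  have h1 : (q = p + e μ) ↔ (p = q - e μ) := by rw [eq_sub_iff_add_eq, eq_comm]
  have h2 : (q = p - e μ) ↔ (p = q + e μ) := by
    constructor
    · intro h; rw [h]; abel
    · intro h; rw [h]; abel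
  simp only [h1, h2]
  rw [add_comm]

/-- Off the diagonal the Laplacian kernel is minus the adjacency indicator. [folklore] -/
theorem lapKer_eq_neg_adjR {p q : X d} (h : p ≠ q) : lapKer p q = -adjR p q := by
  unfold lapKer lapDir adjR
  rw [← Finset.sum_neg_distrib]
  refine Finset.sum_congr rfl fun μ _ => ?_
  rw [if_neg (Ne.symm h)]
  ring

/-- Adjacent sites are at distance `≤ 1`. [folklore] -/
theorem dist_le_one_of_adjR_ne {p q : X d} (h : adjR p q ≠ 0) : dist p q ≤ 1 := by
  by_contra hne
  apply h
  unfold adjR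
  refine Finset.sum_eq_zero fun μ _ => ?_
  have h1 : q ≠ p + e μ := fun hq => hne (by rw [hq]; exact dist_add_e_le p μ)
  have h2 : q ≠ p - e μ := fun hq => hne (by rw [hq]; exact dist_sub_e_le p μ)
  rw [if_neg h1, if_neg h2, add_zero]

/-- Every site has at most `2d` neighbours in any finite set. [folklore] -/
theorem sum_adjR_le (p : X d) (s : Finset (X d)) : ∑ q ∈ s, adjR p q ≤ 2 * d := by
  unfold adjR
  rw [Finset.sum_comm]
  have hterm : ∀ μ : Fin d, ∑ q ∈ s, ((if q = p + e μ then (1 : ℝ) else 0) + (if q = p - e μ then 1 else 0)) ≤ 2 := by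
    intro μ
    rw [Finset.sum_add_distrib, Finset.sum_ite_eq', Finset.sum_ite_eq']
    split_ifs <;> norm_num
  calc ∑ μ : Fin d, ∑ q ∈ s, ((if q = p + e μ then (1 : ℝ) else 0) + (if q = p - e μ then 1 else 0))
      ≤ ∑ _μ : Fin d, (2 : ℝ) := Finset.sum_le_sum fun μ _ => hterm μ
    _ = 2 * d := by simp [mul_comm]

/-- The number of sites of a block: `|B(y)| = (n+1)^d`. [folklore] -/
theorem card_B (n : ℕ) (y : X d) : ((B n y).card : ℝ) = ((n : ℝ) + 1) ^ d := by
  have h := sum_B_const (n := n) y (1 : ℝ)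
  simpa using h

/-- A finite set meets a block in at most `(n+1)^d` sites. [folklore] -/
theorem card_filter_blk_le (n : ℕ) (Λ : Finset (X d)) (y : X d) :
    ((Λ.filter fun q => blk n q = y).card : ℝ) ≤ ((n : ℝ) + 1) ^ d := by
  rw [← card_B n y]
  exact_mod_cast Finset.card_le_card fun q hq => mem_B.2 (Finset.mem_filter.1 hq).2

/-- **Lower block distance**: sites of `B(y)`, `B(y')` are at site distance `≥ (n+1)|y − y'|_∞ − n`. [folklore] -/
theorem dist_blk_ge {n : ℕ} {y y' p q : X d} (hp : p ∈ B n y) (hq : q ∈ B n y') :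
    ((n : ℝ) + 1) * dist y y' - n ≤ dist p q := by
  have hn1 : (0 : ℝ) < (n : ℝ) + 1 := by positivity
  have key : dist y y' ≤ (dist p q + n) / ((n : ℝ) + 1) := by
    refine (dist_pi_le_iff (by positivity)).2 fun μ => ?_
    have h1 := side_mul_blk_add_loc n p μ
    have h2 := side_mul_blk_add_loc n q μ
    rw [mem_B.1 hp] at h1
    rw [mem_B.1 hq] at h2
    have l1 := loc_nonneg n p μ; have l2 := loc_le n p μ
    have l3 := loc_nonneg n q μ; have l4 := loc_le n q μ
    have hd : dist (p μ) (q μ) ≤ dist p q := dist_le_pi_dist p q μ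
    rw [Int.dist_eq] at hd ⊢
    have e1 : side n * (y μ - y' μ) = (p μ - q μ) - (loc n p μ - loc n q μ) := by rw [← h1, ← h2]; ring
    have hZ : side n * |y μ - y' μ| ≤ |p μ - q μ| + n := by
      have a2 : |side n * (y μ - y' μ)| ≤ |p μ - q μ| + |loc n p μ - loc n q μ| := by
        rw [e1]; exact abs_sub _ _
      have a3 : |loc n p μ - loc n q μ| ≤ n := by rw [abs_le]; constructor <;> linarith
      rw [abs_mul, abs_of_pos (side_facts n).1] at a2
      linarith
    have hR : (((n : ℤ) + 1 : ℤ) : ℝ) * |((y μ : ℤ) : ℝ) - ((y' μ : ℤ) : ℝ)|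
        ≤ |((p μ : ℤ) : ℝ) - ((q μ : ℤ) : ℝ)| + n := by
      unfold side at hZ; exact_mod_cast hZ
    push_cast at hR
    rw [le_div_iff₀ hn1]
    linarith
  have := (le_div_iff₀ hn1).1 key
  linarith

/-- The distance from a site to a nonempty finite set `T`. [folklore] -/
def dT (T : Finset (X d)) (hT : T.Nonempty) (x : X d) : ℝ := T.inf' hT fun q => dist x q

/-- On `T` the distance weight is `≤ 0` (it is `0`). [folklore] -/
theorem dT_le_zero_of_mem {T : Finset (X d)} (hT : T.Nonempty) {x : X d} (hx : x ∈ T) : dT T hT x ≤ 0 := by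
  have h : dT T hT x ≤ dist x x := Finset.inf'_le _ hx
  rwa [dist_self] at h

/-- A common lower bound of the distances to `T` bounds `dT` from below. [folklore] -/
theorem le_dT {T : Finset (X d)} (hT : T.Nonempty) {x : X d} {R : ℝ} (h : ∀ q ∈ T, R ≤ dist x q) :
    R ≤ dT T hT x :=
  Finset.le_inf' hT _ h

/-- `dT` is `1`-Lipschitz for the sup metric. [folklore] -/
theorem abs_dT_sub_le {T : Finset (X d)} (hT : T.Nonempty) (x x' : X d) :
    |dT T hT x - dT T hT x'| ≤ dist x x' := by
  have one : ∀ x x' : X d, dT T hT x ≤ dist x x' + dT T hT x' := by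
    intro x x'
    obtain ⟨t, ht, hmin⟩ := Finset.exists_mem_eq_inf' hT fun q => dist x' q
    have hk : dT T hT x' = dist x' t := hmin
    calc dT T hT x ≤ dist x t := Finset.inf'_le _ ht
      _ ≤ dist x x' + dist x' t := dist_triangle _ _ _
      _ = dist x x' + dT T hT x' := by rw [hk]
  rw [abs_sub_le_iff]
  constructor
  · linarith [one x x']
  · linarith [one x' x, dist_comm x x']

/-! ## §3  Index transport `B4.Idx Λ 1 = Λ × Fin 1 ↔ Λ ⊂ ℤ^d` -/

/-- A sum over B4's index set `Λ × Fin 1` is a sum over `Λ`. [folklore] -/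
theorem sum_idx (Λ : Finset (X d)) (F : X d → ℝ) : ∑ k : B4.Idx Λ 1, F (k.1 : X d) = ∑ q ∈ Λ, F q := by
  rw [Fintype.sum_prod_type]
  simp only [Finset.univ_unique, Fin.default_eq_zero, Finset.sum_singleton]
  exact Finset.sum_coe_sort Λ F

/-- A sum over the indices lying over `T ⊆ Λ` is a sum over `T`. [folklore] -/
theorem sum_idx_mem (Λ : Finset (X d)) {T : Finset (X d)} (hT : T ⊆ Λ) (F : X d → ℝ) :
    ∑ k : B4.Idx Λ 1, (if (k.1 : X d) ∈ T then F k.1 else 0) = ∑ q ∈ T, F q := by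
  calc ∑ k : B4.Idx Λ 1, (if (k.1 : X d) ∈ T then F k.1 else 0)
      = ∑ q ∈ Λ, (if q ∈ T then F q else 0) := sum_idx Λ (fun q => if q ∈ T then F q else 0)
    _ = ∑ q ∈ T, F q := by rw [Finset.sum_ite_mem, Finset.inter_eq_right.2 hT]

/-- The `Fin 1` component of a B4 index is `0`. [folklore] -/
theorem idx_snd_eq (Λ : Finset (X d)) (k : B4.Idx Λ 1) : k.2 = 0 := Fin.eq_zero k.2

/-- B4 indices with `N = 1` are determined by their site. [folklore] -/
theorem idx_ext {Λ : Finset (X d)} {j k : B4.Idx Λ 1} (h : (j.1 : X d) = k.1) : j = k :=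
  Prod.ext (Subtype.ext h) (by rw [idx_snd_eq, idx_snd_eq])

/-- The compression `A_Λ` of `Aker` is the site matrix `AX`. [folklore] -/
theorem toMat_Aker (n : ℕ) (a : ℝ) (Λ : Finset (X d)) (j k : B4.Idx Λ 1) :
    toMat Λ (Aker n a) j k = AX n a (j.1 : X d) k.1 := rfl

/-! ## §4  The conjugation error of `A_Λ = (Δ^η + aQ*Q)_Λ` — uniformly in `Λ` and in the mesh -/

/-- **Conjugation error, mesh-free.**  For every finite `Λ ⊂ ℤ^d` and every weight `φ` oscillating by `≤ δ_u·η` across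
bonds and by `≤ δ_u` inside blocks (`η = 1/(n+1)`):
`Σ_{j,k} (e^{φ_j−φ_k} − 1)(A_Λ)_{jk} w_j w_k ≥ −(min(2,a)/2)‖w‖²`.  The Dirichlet excess diagonal of the compression
carries no conjugation error (`e⁰ − 1 = 0`), so `Beta.CombesThomasFormOp.conjError_lap_add_blocks_ge` applies to the
matrix `lap c + Σ_b m_b u_b ⊗ u_b` agreeing with `A_Λ` off the diagonal. [folklore] -/
theorem conjError_toMat (n : ℕ) {a : ℝ} (ha : 0 < a) (Λ : Finset (X d)) (φ : B4.Idx Λ 1 → ℝ)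
    (hφ1 : ∀ j k : B4.Idx Λ 1, dist (j.1 : X d) k.1 ≤ 1 → |φ j - φ k| ≤ deltaU d a * ((n : ℝ) + 1)⁻¹)
    (hφ2 : ∀ j k : B4.Idx Λ 1, blk n (j.1 : X d) = blk n k.1 → |φ j - φ k| ≤ deltaU d a)
    (w : B4.Idx Λ 1 → ℝ) :
    -(min 2 a / 2) * (w ⬝ᵥ w)
      ≤ ∑ j, ∑ k, (Real.exp (φ j - φ k) - 1) * toMat Λ (Aker n a) j k * (w j * w k) := by
  classical
  set δ := deltaU d a with hδdef
  set η : ℝ := ((n : ℝ) + 1)⁻¹ with hηdef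
  have hn1 : (0 : ℝ) < (n : ℝ) + 1 := by positivity
  have hη : 0 < η := by positivity
  have hδ0 : 0 ≤ δ := (deltaU_pos d ha).le
  have hδ1 : δ ≤ 1 := deltaU_le_one d a
  have hη1 : η ≤ 1 := by
    rw [hηdef]; exact inv_le_one_of_one_le₀ (by linarith [(Nat.cast_nonneg n : (0:ℝ) ≤ n)])
  have hδη1 : δ * η ≤ 1 := by nlinarith
  have hsq : (η ^ 2)⁻¹ = ((n : ℝ) + 1) ^ 2 := by rw [hηdef, inv_pow, inv_inv]
  -- the data of `lap c + Σ_b m_b u_b ⊗ u_b`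
  let β : Type := ↥(Λ.image (blk n))
  let c : B4.Idx Λ 1 → B4.Idx Λ 1 → ℝ := fun j k => ((n : ℝ) + 1) ^ 2 * adjR (j.1 : X d) k.1
  let bI : B4.Idx Λ 1 → β := fun k => ⟨blk n (k.1 : X d), Finset.mem_image_of_mem _ k.1.2⟩
  let m : β → ℝ := fun _ => a / ((n : ℝ) + 1) ^ d
  let u : β → B4.Idx Λ 1 → ℝ := fun b k => if blk n (k.1 : X d) = b.1 then 1 else 0
  let H' : Matrix (B4.Idx Λ 1) (B4.Idx Λ 1) ℝ := fun j k => lap c j k + ∑ b, m b * (u b j * u b k)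
  have hc : ∀ j k, c j k = c k j := fun j k => by simp only [c, adjR_symm]
  have hc0 : ∀ j k, 0 ≤ c j k := fun j k => by positivity [adjR_nonneg (j.1 : X d) k.1]
  have hm : ∀ b, 0 ≤ m b := fun b => by positivity
  have hu : ∀ b j, bI j ≠ b → u b j = 0 := by
    intro b j hj
    have : blk n (j.1 : X d) ≠ b.1 := fun h => hj (Subtype.ext h)
    simp only [u, if_neg this]
  -- the block sum reproduces `a(n+1)^{-d}·1[same block]`
  have hblocks : ∀ j k : B4.Idx Λ 1, ∑ b, m b * (u b j * u b k)
      = a / ((n : ℝ) + 1) ^ d * sameBlk n (j.1 : X d) k.1 := by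
    intro j k
    simp only [m, u, sameBlk]
    rw [← Finset.mul_sum]
    congr 1
    have h1 : ∀ b : β, ((if blk n (j.1 : X d) = b.1 then (1:ℝ) else 0) * (if blk n (k.1 : X d) = b.1 then 1 else 0))
        = (if blk n (j.1 : X d) = b.1 then (if blk n (j.1 : X d) = blk n (k.1 : X d) then 1 else 0) else 0) := by
      intro b
      by_cases hj : blk n (j.1 : X d) = b.1
      · rw [if_pos hj, if_pos hj, one_mul, hj]
        by_cases hk : blk n (k.1 : X d) = b.1
        · rw [if_pos hk, if_pos hk.symm]
        · rw [if_neg hk, if_neg (Ne.symm hk)]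
      · rw [if_neg hj, if_neg hj, zero_mul]
    simp_rw [h1]
    rw [Finset.sum_coe_sort (Λ.image (blk n))
      (fun y => if blk n (j.1 : X d) = y then (if blk n (j.1 : X d) = blk n (k.1 : X d) then (1:ℝ) else 0) else 0)]
    rw [Finset.sum_ite_eq]
    rw [if_pos (Finset.mem_image_of_mem _ j.1.2)]
  -- off the diagonal `A_Λ = H'`
  have hoff : ∀ j k : B4.Idx Λ 1, j ≠ k → toMat Λ (Aker n a) j k = H' j k := by
    intro j k hjk
    have hjk' : (j.1 : X d) ≠ k.1 := fun h => hjk (idx_ext h)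
    simp only [H', toMat_Aker, AX, lap_apply, if_neg hjk, hblocks j k, c]
    rw [lapKer_eq_neg_adjR hjk']
    ring
  -- the two conjugation-error sums agree
  have hsum : ∑ j, ∑ k, (Real.exp (φ j - φ k) - 1) * toMat Λ (Aker n a) j k * (w j * w k)
      = ∑ j, ∑ k, (Real.exp (φ j - φ k) - 1) * H' j k * (w j * w k) := by
    refine Finset.sum_congr rfl fun j _ => Finset.sum_congr rfl fun k _ => ?_
    by_cases hjk : j = k
    · subst hjk; simp
    · rw [hoff j k hjk]
  rw [hsum]
  -- defects
  have hκΔ : ∀ j, ∑ k, c j k * (Real.cosh (φ j - φ k) - 1) ≤ 2 * d * δ ^ 2 := by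
    intro j
    have hterm : ∀ k, c j k * (Real.cosh (φ j - φ k) - 1) ≤ δ ^ 2 * adjR (j.1 : X d) k.1 := by
      intro k
      by_cases h0 : adjR (j.1 : X d) k.1 = 0
      · simp only [c, h0, mul_zero, zero_mul, le_refl]
      · have hd := dist_le_one_of_adjR_ne h0
        have hb := hφ1 j k hd
        have key : (η ^ 2)⁻¹ * (Real.cosh (φ j - φ k) - 1) ≤ δ ^ 2 :=
          inv_sq_mul_cosh_sub_one_le hη hb hδη1
        rw [hsq] at key
        have ha0 := adjR_nonneg (j.1 : X d) k.1
        calc c j k * (Real.cosh (φ j - φ k) - 1)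
            = adjR (j.1 : X d) k.1 * (((n : ℝ) + 1) ^ 2 * (Real.cosh (φ j - φ k) - 1)) := by simp only [c]; ring
          _ ≤ adjR (j.1 : X d) k.1 * δ ^ 2 := mul_le_mul_of_nonneg_left key ha0
          _ = δ ^ 2 * adjR (j.1 : X d) k.1 := mul_comm _ _
    calc ∑ k, c j k * (Real.cosh (φ j - φ k) - 1) ≤ ∑ k, δ ^ 2 * adjR (j.1 : X d) k.1 :=
          Finset.sum_le_sum fun k _ => hterm k
      _ = δ ^ 2 * ∑ q ∈ Λ, adjR (j.1 : X d) q := by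
          rw [← Finset.mul_sum, sum_idx Λ (fun q => adjR (j.1 : X d) q)]
      _ ≤ δ ^ 2 * (2 * d) := mul_le_mul_of_nonneg_left (sum_adjR_le _ _) (sq_nonneg _)
      _ = 2 * d * δ ^ 2 := by ring
  have hε0 : ∀ _b : β, 0 ≤ Real.exp δ - 1 := fun _ => by linarith [Real.add_one_le_exp δ]
  have hε : ∀ b j k, bI j = b → bI k = b → |Real.exp (φ j - φ k) - 1| ≤ Real.exp δ - 1 := by
    intro b j k hj hk
    have hjk : blk n (j.1 : X d) = blk n (k.1 : X d) := by
      have := congrArg Subtype.val (hj.trans hk.symm); exact this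
    exact abs_exp_sub_one_le (hφ2 j k hjk)
  have hκQ : ∀ b : β, m b * (Real.exp δ - 1) * ∑ k, u b k ^ 2 ≤ a * (Real.exp δ - 1) := by
    intro b
    have hu2 : ∑ k, u b k ^ 2 = ∑ k : B4.Idx Λ 1, (if blk n (k.1 : X d) = b.1 then (1:ℝ) else 0) := by
      refine Finset.sum_congr rfl fun k _ => ?_
      simp only [u]; split_ifs <;> norm_num
    have hcnt : ∑ k : B4.Idx Λ 1, (if blk n (k.1 : X d) = b.1 then (1:ℝ) else 0) ≤ ((n : ℝ) + 1) ^ d := by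
      rw [sum_idx Λ (fun q => if blk n q = b.1 then (1:ℝ) else 0), Finset.sum_boole]
      exact_mod_cast card_filter_blk_le n Λ b.1
    have hpow : (0 : ℝ) < ((n : ℝ) + 1) ^ d := by positivity
    rw [hu2]
    calc m b * (Real.exp δ - 1) * ∑ k : B4.Idx Λ 1, (if blk n (k.1 : X d) = b.1 then (1:ℝ) else 0)
        ≤ m b * (Real.exp δ - 1) * ((n : ℝ) + 1) ^ d :=
          mul_le_mul_of_nonneg_left hcnt (mul_nonneg (hm b) (hε0 b))
      _ = a * (Real.exp δ - 1) := by simp only [m]; field_simp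
  have herr := conjError_lap_add_blocks_ge c hc hc0 bI m hm u hu H' (fun _ _ => rfl) φ
    (2 * d * δ ^ 2) (a * (Real.exp δ - 1)) hκΔ (fun _ => Real.exp δ - 1) hε0 hε hκQ w
  have hsmall := smallness d ha
  have hww : 0 ≤ w ⬝ᵥ w := Finset.sum_nonneg fun i _ => mul_self_nonneg (w i)
  have : -(min 2 a / 2) * (w ⬝ᵥ w) ≤ -(2 * d * δ ^ 2 + a * (Real.exp δ - 1)) * (w ⬝ᵥ w) := by
    nlinarith
  exact this.trans herr


/-! ## §5  Finite volume: set-to-set decay of `A_Λ⁻¹ = ((Δ^η + aQ*Q)_Λ)⁻¹`, uniformly in `Λ` and in the mesh -/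

/-- **Finite-volume Combes–Thomas bound, mesh-free constants.**  For every finite `Λ ⊂ ℤ^d`, `S, T ⊆ Λ` at site
distance `≥ R`, and all `f, g`:
`|Σ_{p∈S} Σ_{q∈T} f(p) (A_Λ⁻¹)(p,q) g(q)| ≤ (2/min(2,a)) e^{−δ_u R/(n+1)} ‖f‖_{ℓ²(S)} ‖g‖_{ℓ²(T)}`,
i.e. `‖1_S A_Λ⁻¹ 1_T‖_{ℓ²→ℓ²} ≤ (2/min(2,a)) e^{−δ_u·η·dist(S,T)}` with `η·dist(S,T)` the PHYSICAL distance.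
[cite: CombesThomas1973, §II] [folklore] -/
theorem finInv_setDecay (n : ℕ) {a : ℝ} (ha : 0 < a) (Λ S T : Finset (X d)) (hS : S ⊆ Λ) (hT : T ⊆ Λ)
    (R : ℝ) (hR : ∀ p ∈ S, ∀ q ∈ T, R ≤ dist p q) (f g : X d → ℝ) :
    |∑ p ∈ S, ∑ q ∈ T, f p * finInv Λ (Aker n a) (p, 0) (q, 0) * g q|
      ≤ 2 / min 2 a * Real.exp (-(deltaU d a * (R / ((n : ℝ) + 1))))
        * Real.sqrt (∑ p ∈ S, f p ^ 2) * Real.sqrt (∑ q ∈ T, g q ^ 2) := by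
  classical
  have hσ : 0 < min 2 a := lt_min two_pos ha
  rcases T.eq_empty_or_nonempty with hTe | hTne
  · subst hTe; simp
  set δ := deltaU d a with hδdef
  set η : ℝ := ((n : ℝ) + 1)⁻¹ with hηdef
  have hn1 : (0 : ℝ) < (n : ℝ) + 1 := by positivity
  have hη : 0 < η := by positivity
  have hδ0 : 0 ≤ δ := (deltaU_pos d ha).le
  have hηR : R / ((n : ℝ) + 1) = η * R := by rw [hηdef, div_eq_inv_mul]
  -- the matrix, its inverse, the data
  set H := toMat Λ (Aker n a) with hHdef
  have hA := hyp56Z_Aker (d := d) n a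
  have hunit : IsUnit H := isUnit_of_hyp56 hσ (hA.hyp56 Λ (Set.subset_univ _))
  have hdet : IsUnit H.det := (Matrix.isUnit_iff_isUnit_det H).1 hunit
  let φ : B4.Idx Λ 1 → ℝ := fun k => δ * η * dT T hTne (k.1 : X d)
  let g' : B4.Idx Λ 1 → ℝ := fun k => if (k.1 : X d) ∈ T then g k.1 else 0
  let v : B4.Idx Λ 1 → ℝ := H⁻¹.mulVec g'
  let S' : Finset (B4.Idx Λ 1) := Finset.univ.filter fun k => (k.1 : X d) ∈ S
  let T' : Finset (B4.Idx Λ 1) := Finset.univ.filter fun k => (k.1 : X d) ∈ T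
  -- hypotheses of `setDecay_form_op`
  have hpos : ∀ ω : B4.Idx Λ 1 → ℝ, min 2 a * (ω ⬝ᵥ ω) ≤ ω ⬝ᵥ H.mulVec ω := by
    intro ω
    have h := hA.coercive Λ (Set.subset_univ _) ω
    have e1 : ω ⬝ᵥ ω = ∑ p, ω p ^ 2 := by simp [dotProduct, pow_two]
    rw [e1]; exact h
  have hφ1 : ∀ j k : B4.Idx Λ 1, dist (j.1 : X d) k.1 ≤ 1 → |φ j - φ k| ≤ deltaU d a * ((n : ℝ) + 1)⁻¹ := by
    intro j k hjk
    have h := abs_dT_sub_le hTne (j.1 : X d) k.1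
    show |δ * η * dT T hTne (j.1 : X d) - δ * η * dT T hTne (k.1 : X d)| ≤ δ * η
    rw [← mul_sub, abs_mul, abs_of_nonneg (by positivity : 0 ≤ δ * η)]
    calc δ * η * |dT T hTne (j.1 : X d) - dT T hTne (k.1 : X d)| ≤ δ * η * 1 :=
          mul_le_mul_of_nonneg_left (h.trans hjk) (by positivity)
      _ = δ * η := mul_one _
  have hφ2 : ∀ j k : B4.Idx Λ 1, blk n (j.1 : X d) = blk n k.1 → |φ j - φ k| ≤ deltaU d a := by
    intro j k hjk
    have h := abs_dT_sub_le hTne (j.1 : X d) k.1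
    have hd := dist_le_of_blk_eq hjk
    show |δ * η * dT T hTne (j.1 : X d) - δ * η * dT T hTne (k.1 : X d)| ≤ δ
    rw [← mul_sub, abs_mul, abs_of_nonneg (by positivity : 0 ≤ δ * η)]
    have hηn : η * n ≤ 1 := by
      rw [hηdef, inv_mul_le_iff₀ hn1]; linarith
    calc δ * η * |dT T hTne (j.1 : X d) - dT T hTne (k.1 : X d)| ≤ δ * η * n :=
          mul_le_mul_of_nonneg_left (h.trans hd) (by positivity)
      _ = δ * (η * n) := by ring
      _ ≤ δ * 1 := mul_le_mul_of_nonneg_left hηn hδ0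
      _ = δ := mul_one _
  have herr := conjError_toMat n ha Λ φ hφ1 hφ2
  have hlo : ∀ i ∈ S', δ * η * R ≤ φ i := by
    intro i hi
    have hiS : (i.1 : X d) ∈ S := (Finset.mem_filter.1 hi).2
    have h := le_dT hTne (hR _ hiS)
    exact mul_le_mul_of_nonneg_left h (by positivity)
  have hhi : ∀ j ∈ T', φ j ≤ 0 := by
    intro j hj
    have hjT : (j.1 : X d) ∈ T := (Finset.mem_filter.1 hj).2
    exact mul_nonpos_of_nonneg_of_nonpos (by positivity) (dT_le_zero_of_mem hTne hjT)
  have hg : ∀ j, j ∉ T' → g' j = 0 := by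
    intro j hj
    have : (j.1 : X d) ∉ T := fun h => hj (Finset.mem_filter.2 ⟨Finset.mem_univ _, h⟩)
    simp only [g', if_neg this]
  have hv : H.mulVec v = g' := by
    show H.mulVec (H⁻¹.mulVec g') = g'
    rw [Matrix.mulVec_mulVec, Matrix.mul_nonsing_inv H hdet, Matrix.one_mulVec]
  have main := setDecay_form_op H (min 2 a) φ hσ hpos herr S' T' (δ * η * R) 0 hlo hhi g' v hg hv
  -- identify the sums
  have hg2 : ∑ j, g' j ^ 2 = ∑ q ∈ T, g q ^ 2 := by
    have h1 : ∀ j : B4.Idx Λ 1, g' j ^ 2 = if (j.1 : X d) ∈ T then g j.1 ^ 2 else 0 := by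
      intro j; simp only [g']; split_ifs <;> simp
    simp_rw [h1]
    exact sum_idx_mem Λ hT (fun q => g q ^ 2)
  have hvi : ∀ i : B4.Idx Λ 1, v i = ∑ q ∈ T, finInv Λ (Aker n a) ((i.1 : X d), 0) (q, 0) * g q := by
    intro i
    show ∑ k, H⁻¹ i k * g' k = _
    have h1 : ∀ k : B4.Idx Λ 1, H⁻¹ i k * g' k
        = if (k.1 : X d) ∈ T then finInv Λ (Aker n a) ((i.1 : X d), 0) (k.1, 0) * g k.1 else 0 := by
      intro k
      simp only [g']
      split_ifs with hk
      · rw [hHdef, inv_toMat_apply, idx_snd_eq Λ i, idx_snd_eq Λ k]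
      · rw [mul_zero]
    simp_rw [h1]
    exact sum_idx_mem Λ hT (fun q => finInv Λ (Aker n a) ((i.1 : X d), 0) (q, 0) * g q)
  have hLHS : ∑ p ∈ S, ∑ q ∈ T, f p * finInv Λ (Aker n a) (p, 0) (q, 0) * g q
      = ∑ i ∈ S', f (i.1 : X d) * v i := by
    simp_rw [hvi]
    rw [Finset.sum_filter]
    rw [sum_idx_mem Λ hS (fun p => f p * ∑ q ∈ T, finInv Λ (Aker n a) (p, 0) (q, 0) * g q)]
    refine Finset.sum_congr rfl fun p _ => ?_
    rw [Finset.mul_sum]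
    exact Finset.sum_congr rfl fun q _ => by ring
  have hf2 : ∑ i ∈ S', f (i.1 : X d) ^ 2 = ∑ p ∈ S, f p ^ 2 := by
    rw [Finset.sum_filter]; exact sum_idx_mem Λ hS (fun p => f p ^ 2)
  -- assemble
  rw [hLHS]
  -- Cauchy–Schwarz `|Σ f v| ≤ √(Σ f²) √(Σ v²)`
  have hCS : |∑ i ∈ S', f (i.1 : X d) * v i|
      ≤ Real.sqrt (∑ p ∈ S, f p ^ 2) * Real.sqrt (∑ i ∈ S', v i ^ 2) := by
    rw [← hf2, ← Real.sqrt_mul (Finset.sum_nonneg fun i _ => sq_nonneg _)]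
    exact Real.abs_le_sqrt (Finset.sum_mul_sq_le_sq_mul_sq S' (fun i => f (i.1 : X d)) v)
  have hv2 : Real.sqrt (∑ i ∈ S', v i ^ 2)
      ≤ 2 / min 2 a * Real.exp (-(δ * (η * R))) * Real.sqrt (∑ q ∈ T, g q ^ 2) := by
    rw [hg2, sub_zero] at main
    have h1 : (2 / min 2 a) ^ 2 * Real.exp (-(2 * (δ * η * R))) * ∑ q ∈ T, g q ^ 2
        = (2 / min 2 a * Real.exp (-(δ * (η * R)))) ^ 2 * ∑ q ∈ T, g q ^ 2 := by
      rw [mul_pow, sq (Real.exp _), ← Real.exp_add]; ring_nf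
    rw [h1] at main
    calc Real.sqrt (∑ i ∈ S', v i ^ 2)
        ≤ Real.sqrt ((2 / min 2 a * Real.exp (-(δ * (η * R)))) ^ 2 * ∑ q ∈ T, g q ^ 2) := Real.sqrt_le_sqrt main
      _ = 2 / min 2 a * Real.exp (-(δ * (η * R))) * Real.sqrt (∑ q ∈ T, g q ^ 2) := by
          rw [Real.sqrt_mul (sq_nonneg _), Real.sqrt_sq (by positivity)]
  rw [hηR]
  calc |∑ i ∈ S', f (i.1 : X d) * v i| ≤ Real.sqrt (∑ p ∈ S, f p ^ 2) * Real.sqrt (∑ i ∈ S', v i ^ 2) := hCS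
    _ ≤ Real.sqrt (∑ p ∈ S, f p ^ 2) * (2 / min 2 a * Real.exp (-(δ * (η * R))) * Real.sqrt (∑ q ∈ T, g q ^ 2)) :=
        mul_le_mul_of_nonneg_left hv2 (Real.sqrt_nonneg _)
    _ = 2 / min 2 a * Real.exp (-(δ * (η * R))) * Real.sqrt (∑ p ∈ S, f p ^ 2) * Real.sqrt (∑ q ∈ T, g q ^ 2) := by
        ring

/-! ## §6  The whole lattice: passage `Λ ↗ Ω` through the exhaustion limit of B4Sect5Exhaustion -/

/-- **Set-to-set decay of `G'_Ω = lim_Λ (A_Λ)⁻¹` on any `Ω ⊆ ℤ^d` — in particular of `G' = (Δ^η + aQ*Q)⁻¹` on the whole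
fine lattice (`Ω = ℤ^d`)**, mesh-free constants: for finite `S, T ⊆ Ω` at site distance `≥ R`,
`|Σ_{p∈S} Σ_{q∈T} f(p) G'_Ω(p,q) g(q)| ≤ (2/min(2,a)) e^{−δ_u R/(n+1)} ‖f‖_{ℓ²(S)} ‖g‖_{ℓ²(T)}`.
[cite: Balaban1984PropagatorsI, p.36 remark] [cite: CombesThomas1973, §II] [folklore] -/
theorem gPrime_setDecay (n : ℕ) {a : ℝ} (ha : 0 < a) (Ω : Set (X d)) (S T : Finset (X d))
    (hS : (↑S : Set (X d)) ⊆ Ω) (hT : (↑T : Set (X d)) ⊆ Ω)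
    (R : ℝ) (hR : ∀ p ∈ S, ∀ q ∈ T, R ≤ dist p q) (f g : X d → ℝ) :
    |∑ p ∈ S, ∑ q ∈ T, f p * limInv Ω (Aker n a) (p, 0) (q, 0) * g q|
      ≤ 2 / min 2 a * Real.exp (-(deltaU d a * (R / ((n : ℝ) + 1))))
        * Real.sqrt (∑ p ∈ S, f p ^ 2) * Real.sqrt (∑ q ∈ T, g q ^ 2) := by
  have hσ : 0 < min 2 a := lt_min two_pos ha
  have hc : 0 < c0 d n a := c0_pos d n ha.ne'
  have hA : Hyp56Z Ω (Aker (d := d) n a) (min 2 a) (c0 d n a) 1 := (hyp56Z_Aker n a).mono (Set.subset_univ Ω)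
  have hlim : Tendsto (fun m => ∑ p ∈ S, ∑ q ∈ T, f p * finInv (cut Ω m) (Aker n a) (p, 0) (q, 0) * g q) atTop
      (𝓝 (∑ p ∈ S, ∑ q ∈ T, f p * limInv Ω (Aker n a) (p, 0) (q, 0) * g q)) := by
    refine tendsto_finsetSum S fun p _ => tendsto_finsetSum T fun q _ => ?_
    exact ((tendsto_limInv hσ hc one_pos hA (p, 0) (q, 0)).const_mul (f p)).mul_const (g q)
  refine le_of_tendsto hlim.abs (eventually_atTop.2 ⟨(S ∪ T).sup rad, fun m hm => ?_⟩)
  have hSm : S ⊆ cut Ω m := fun p hp =>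
    mem_cut_of_rad_le (hS hp) ((Finset.le_sup (f := rad) (Finset.mem_union_left T hp)).trans hm)
  have hTm : T ⊆ cut Ω m := fun q hq =>
    mem_cut_of_rad_le (hT hq) ((Finset.le_sup (f := rad) (Finset.mem_union_right S hq)).trans hm)
  exact finInv_setDecay n ha (cut Ω m) S T hSm hTm R hR f g

/-- **Entry decay of `G'_Ω`, mesh-free**: `|G'_Ω(p,q)| ≤ (2/min(2,a)) e^{−δ_u |p−q|_∞/(n+1)}` — exponential decay in the
PHYSICAL distance `η|p−q|_∞`, with constants depending on `d, a` only. [cite: Balaban1983RegularityDecay, (1.10) p.573]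
[folklore] -/
theorem gPrime_entry_decay (n : ℕ) {a : ℝ} (ha : 0 < a) (Ω : Set (X d)) {p q : X d} (hp : p ∈ Ω) (hq : q ∈ Ω) :
    |limInv Ω (Aker n a) (p, 0) (q, 0)| ≤ 2 / min 2 a * Real.exp (-(deltaU d a * (dist p q / ((n : ℝ) + 1)))) := by
  have h := gPrime_setDecay n ha Ω {p} {q} (by simpa using hp) (by simpa using hq) (dist p q)
    (fun p' hp' q' hq' => by rw [Finset.mem_singleton.1 hp', Finset.mem_singleton.1 hq'])
    (fun _ => 1) (fun _ => 1)
  simpa using h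

/-- **Block-to-block decay of `G'` on the whole lattice**, mesh-free:
`|Σ_{p∈B(y)} Σ_{q∈B(y')} G'(p,q)| ≤ (n+1)^d (2/min(2,a)) e^{δ_u} e^{−δ_u|y−y'|_∞}`. [folklore] -/
theorem gPrime_block_decay (n : ℕ) {a : ℝ} (ha : 0 < a) (y y' : X d) :
    |∑ p ∈ B n y, ∑ q ∈ B n y', limInv Set.univ (Aker n a) (p, 0) (q, 0)|
      ≤ ((n : ℝ) + 1) ^ d * (2 / min 2 a * Real.exp (deltaU d a) * Real.exp (-(deltaU d a * dist y y'))) := by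
  have hσ : 0 < min 2 a := lt_min two_pos ha
  have hn1 : (0 : ℝ) < (n : ℝ) + 1 := by positivity
  have hδ0 : 0 ≤ deltaU d a := (deltaU_pos d ha).le
  set R : ℝ := ((n : ℝ) + 1) * dist y y' - n with hRdef
  have h := gPrime_setDecay n ha Set.univ (B n y) (B n y') (Set.subset_univ _) (Set.subset_univ _) R
    (fun p hp q hq => dist_blk_ge hp hq) (fun _ => 1) (fun _ => 1)
  simp only [one_mul, mul_one, one_pow] at h
  rw [sum_B_const, sum_B_const, mul_one] at h
  have hsq : Real.sqrt (((n : ℝ) + 1) ^ d) * Real.sqrt (((n : ℝ) + 1) ^ d) = ((n : ℝ) + 1) ^ d :=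
    Real.mul_self_sqrt (by positivity)
  have hexp : Real.exp (-(deltaU d a * (R / ((n : ℝ) + 1))))
      ≤ Real.exp (deltaU d a) * Real.exp (-(deltaU d a * dist y y')) := by
    rw [← Real.exp_add]
    refine Real.exp_le_exp.2 ?_
    have hR' : R / ((n : ℝ) + 1) = dist y y' - n / ((n : ℝ) + 1) := by
      rw [hRdef]; field_simp
    have hn' : (n : ℝ) / ((n : ℝ) + 1) ≤ 1 := by
      rw [div_le_one hn1]; linarith
    rw [hR']
    nlinarith
  calc |∑ p ∈ B n y, ∑ q ∈ B n y', limInv Set.univ (Aker n a) (p, 0) (q, 0)|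
      ≤ 2 / min 2 a * Real.exp (-(deltaU d a * (R / ((n : ℝ) + 1))))
          * Real.sqrt (((n : ℝ) + 1) ^ d) * Real.sqrt (((n : ℝ) + 1) ^ d) := h
    _ = ((n : ℝ) + 1) ^ d * (2 / min 2 a * Real.exp (-(deltaU d a * (R / ((n : ℝ) + 1))))) := by
          rw [mul_assoc, hsq]; ring
    _ ≤ ((n : ℝ) + 1) ^ d * (2 / min 2 a * (Real.exp (deltaU d a) * Real.exp (-(deltaU d a * dist y y')))) := by
          refine mul_le_mul_of_nonneg_left (mul_le_mul_of_nonneg_left hexp (by positivity)) (by positivity)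
    _ = ((n : ℝ) + 1) ^ d * (2 / min 2 a * Real.exp (deltaU d a) * Real.exp (-(deltaU d a * dist y y'))) := by
          ring

/-! ## §7  `Q'G'Q'*` on the unit lattice: mesh-free kernel decay, condition (5.6) with mesh-free constants, and the
mesh-free decay of every compression inverse `(Q'G'Q'*)_Λ⁻¹`, `Λ ⊆ ℤ^d` -/

/-- **Mesh-free kernel decay of `Q'G'Q'*`**: `|(Q'G'Q'*)(y,y')| ≤ c_u(d,a) e^{−δ_u(d,a)|y−y'|_∞}` for all unit-lattice
points `y, y'`, all meshes `η = 1/(n+1)`.  (B6 p.237: «a bound from above and an exponential decay of the kernel».)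
[cite: Balaban1984PropagatorsII, p.237] [folklore] -/
theorem abs_kerQGQ_le_unif (n : ℕ) {a : ℝ} (ha : 0 < a) (y y' : X d) :
    |kerQGQ n a y y'| ≤ cU d a * Real.exp (-(deltaU d a * dist y y')) := by
  have hpow : (0 : ℝ) < ((n : ℝ) + 1) ^ d := by positivity
  unfold kerQGQ
  rw [abs_mul, abs_of_pos (inv_pos.2 hpow)]
  calc (((n : ℝ) + 1) ^ d)⁻¹ * |∑ p ∈ B n y, ∑ q ∈ B n y', limInv Set.univ (Aker n a) (p, 0) (q, 0)|
      ≤ (((n : ℝ) + 1) ^ d)⁻¹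
          * (((n : ℝ) + 1) ^ d * (2 / min 2 a * Real.exp (deltaU d a) * Real.exp (-(deltaU d a * dist y y')))) :=
        mul_le_mul_of_nonneg_left (gPrime_block_decay n ha y y') (by positivity)
    _ = cU d a * Real.exp (-(deltaU d a * dist y y')) := by
        rw [← mul_assoc, inv_mul_cancel₀ hpow.ne', one_mul]; rfl

/-- **`Q'G'Q'*` satisfies B4's condition (5.6) on `Ω = ℤ^d` with MESH-FREE constants** `(γ₀, c₀, δ₀) =
(gammaQ d a, c_u(d,a), δ_u(d,a))`: symmetric, `≥ γ₀ I` on finitely supported vectors (B6 (2.76), node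
`B6QGQLower276`), entries `≤ c_u e^{−δ_u|y−y'|}` (this file).  (B6 p.237: «bounded from above and below by absolute
constants … We can use the theory developed in Sect. 5 [3]».) [cite: Balaban1984PropagatorsII, (2.76) p.236, p.237]
[folklore] -/
theorem hyp56Z_KerQGQ_unif (n : ℕ) {a : ℝ} (ha : 0 < a) :
    Hyp56Z (Set.univ : Set (Fin d → ℤ)) (KerQGQ (d := d) n a) (gammaQ d a) (cU d a) (deltaU d a) where
  symm p q _ _ := kerQGQ_symm n ha p.1 q.1
  coercive Λ hΛ v := hyp56Z_coercive_of_finCoercive (finCoercive_KerQGQ n ha) Λ hΛ v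
  decay p q _ _ := abs_kerQGQ_le_unif n ha p.1 q.1

/-- The mesh-free (5.7) constant `c⋆` for `(Q'G'Q'*)_Λ⁻¹`. [folklore] -/
def cInv (d : ℕ) (a : ℝ) : ℝ := cStar d 1 (gammaQ d a) (cU d a) (deltaU d a)

/-- The mesh-free (5.7) rate `δ⋆` for `(Q'G'Q'*)_Λ⁻¹` («a decay rate δ₁ depending on δ₀ and the bound γ₀», p.237).
[folklore] -/
def deltaInv (d : ℕ) (a : ℝ) : ℝ := deltaStar d 1 (gammaQ d a) (cU d a) (deltaU d a)

/-- `cInv > 0`. [folklore] -/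
theorem cInv_pos (d : ℕ) {a : ℝ} (ha : 0 < a) : 0 < cInv d a :=
  cStar_pos d 1 (cU d a) (deltaU d a) (gammaQ_pos d ha)

/-- `deltaInv > 0`. [folklore] -/
theorem deltaInv_pos (d : ℕ) {a : ℝ} (ha : 0 < a) : 0 < deltaInv d a :=
  deltaStar_pos d 1 (gammaQ_pos d ha) (cU_pos d ha).le (deltaU_pos d ha)

/-- **Mesh-free exponential decay of `(Q'G'Q'*)_Λ⁻¹` for EVERY `Λ ⊆ ℤ^d`** (finite or infinite; `Λ = ℤ^d` is the
whole unit lattice): `|(Q'G'Q'*)_Λ⁻¹(y,y')| ≤ c⋆ e^{−δ⋆|y−y'|_∞}` with `c⋆ = cInv d a`, `δ⋆ = deltaInv d a` depending on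
`d, a` only — B4 Sect. 5 Theorem (`B4Sect5Exhaustion.limInv_abs_le`) fed with the mesh-free (5.6) above.  (B6 p.237:
«We can use the theory developed in Sect. 5 [3] to conclude that it has an exponential decay with a decay rate δ₁
depending on δ₀ and the bound γ₀».) [cite: Balaban1984PropagatorsII, p.237] [cite: Balaban1983RegularityDecay, (5.7) p.594]
[folklore] -/
theorem qGqInv_decay_unif (n : ℕ) {a : ℝ} (ha : 0 < a) (Λ : Set (X d)) (y y' : X d) :
    |limInv Λ (KerQGQ n a) (y, 0) (y', 0)| ≤ cInv d a * Real.exp (-(deltaInv d a * dist y y')) :=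
  limInv_abs_le (gammaQ_pos d ha) (cU_pos d ha) (deltaU_pos d ha) ((hyp56Z_KerQGQ_unif n ha).mono (Set.subset_univ Λ))
    (y, 0) (y', 0)

/-- **(5.8)-type volume comparison, mesh-free**: for `Λ ⊆ Λ' ⊆ ℤ^d` the kernels of `(Q'G'Q'*)_Λ⁻¹` and `(Q'G'Q'*)_{Λ'}⁻¹`
differ at `y, y' ∈ Λ` by `≤ c⋆ e^{−δ⋆(dist(y,Λ'∖Λ) + dist(y',Λ'∖Λ))}`-type bounds with the same mesh-free constants —
B4Sect5Exhaustion's (5.8) `limInv_sub_limInv_abs_le` applies verbatim; recorded here as the `Sect5ThmSetOmega`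
package instantiated at mesh-free constants. [cite: Balaban1983RegularityDecay, Sect. 5 Theorem p.594] [folklore] -/
theorem qGq_sect5_unif (n : ℕ) {a : ℝ} (ha : 0 < a) :
    0 < gammaQ d a ∧ 0 < cU d a ∧ 0 < deltaU d a ∧
      Hyp56Z (Set.univ : Set (Fin d → ℤ)) (KerQGQ (d := d) n a) (gammaQ d a) (cU d a) (deltaU d a) :=
  ⟨gammaQ_pos d ha, cU_pos d ha, deltaU_pos d ha, hyp56Z_KerQGQ_unif n ha⟩

end

end Literature.MathematicalPhysics.QuantumFieldTheory.Balaban1983to89.B6QGQDecay237
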